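import Summits.ValiantsHypothesis.ValiantsHypothesis.Theorems.LacunarySymmetroidMatrixDescartesCensusDoorA34NineInertiaChamberIIStrong

/-!
# `MatrixDescartes` census — DOOR A at `(3,4)`: the CHAMBER-II ONE-CROSSING LAW, uniqueness form (kernel): a chamber-II nine-row with bottom letter
# `1` has AT MOST ONE positive-semidefinite singular point

HONEST FRAMING.  Object-search cell `pub-symmetroid`, door-A seat `val-sym-door-p3` (g16); helper file beside the OPEN typed statement
`DoorA34 = PosRootLawAt 3 4 18` (route item `Theses.LacunarySymmetroid.DoorA34`, stmt-ValiantsHypothesis-19980), asserted nowhere here.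
Companions: `…NineInertiaChamberII` (arithmetic core), `…NineInertiaChamberIIGeneral` (`chamberII_logSlope`: log-slope `> −1/2`).  This file removes the
last paper step («√u·λ_min(A+uB) strictly decreasing ⇒ exactly one crossing») WITHOUT calculus:

* (companion `…ChamberIIStrong`: `chamberII_logSlope_strong`, the log-slope bound `> −3/10`, i.e. `10u·σ_B(x) < −3t`);
* `weight_step` — elementary two-point algebra: with `a = σ_A(x)`, `b = σ_B(x)`, `t = a + ub < 0`, `10ub < −3t`, for every `u' ∈ (u, 7u/5]`:
  `u'(a + u'b)² > u t²` and `a + u'b < 0`; since `λ_min(A + u'B) ≤ a + u'b` (Rayleigh), the WEIGHT `W(u) := u·λ_min(A+uB)²` satisfies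
  `W(u') > W(u)` — `W` increases by a factor-`7/5` step from any point;
* `exists_bottom_pair` — every real symmetric `3 × 3` matrix has a unit bottom eigenvector with the Rayleigh minimality property (spectral theorem);
* `weight_increasing` — chaining the steps: `W(u') > W(u)` for ALL `0 < u < u'` (induction on the number of `7/5`-steps);
* **`chamberII_unique_psdSingular`** — for a nine-row `1 + X^{d₁}S₁ + X^{d₂}S₂` with `2d₁ < d₂ < 3d₁` (`S₁, S₂` symmetric): if `F(x₁)` and `F(x₂)` are both
  positive semidefinite and singular with `0 < x₁ ≤ x₂`, then `x₁ = x₂`.  (At a PSD-singular point `λ_min(S₁ + uS₂) = −x^{−d₁}`, `u = x^{d₂−d₁}`, so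
  `W = x^{d₂−3d₁}` is DECREASING in `x` because `d₂ < 3d₁` — against `weight_increasing`.)

Consequence for the flag ladder (with `Census.FlagInertia.flag_inertia_law` / `no_flag_of_indefinite_letter`): a ladder source must be a definite-bottom
nine-row ALL of whose nine det-roots are PSD-singular points — impossible on every chamber-II support.  Nothing here bounds `ζ_sym(3,3)` or
`ζ_sym(3,4)`; `DoorA34`, Claim L on `d₂ < 2d₁` (chambers III/IV) and `MatrixDescartes` (stmt-ValiantsHypothesis-18050) stay OPEN; nothing on `VP ≠ VNP`.
[folklore] Rayleigh quotients, spectral theorem; elementary.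
-/

open Finset Matrix

-- `Summit.ValiantsHypothesis.ValiantsHypothesis.…` repeats a component by the D-0017 layout
-- (single-conjunct summit), which the `dupNamespace` linter flags; the name is mandated.
set_option linter.dupNamespace false

namespace Summit.ValiantsHypothesis.ValiantsHypothesis.Theorems.LacunarySymmetroidMatrixDescartes.Census

namespace NineInertia

open scoped BigOperators Matrix

/-! ## 3. The two-point weight step (no calculus) -/

/-- **Weight step.**  If `t = a + ub < 0` and `10ub < −3t`, then for every `u'` with `u < u' ≤ (7/5)u`: `a + u'b < 0` and `u·t² < u'·(a + u'b)²`.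
(`u'(a+u'b)² − u(a+ub)² = (u'−u)·[(a + b(u+u'))² − b²uu']` and `|a + b(u+u')| > |b|√(uu')`.) [folklore] -/
theorem weight_step {a b u u' t : ℝ} (hu : 0 < u) (huu : u < u') (hu' : u' ≤ 7 / 5 * u) (htab : t = a + u * b) (ht : t < 0)
    (hlaw : 10 * (u * b) < -(3 * t)) : a + u' * b < 0 ∧ u * t ^ 2 < u' * (a + u' * b) ^ 2 := by
  have hneg : a + u' * b < 0 := by
    rcases le_or_gt b 0 with hb | hb
    · nlinarith
    · nlinarith
  refine ⟨hneg, ?_⟩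
  -- u'(a+u'b)^2 - u(a+ub)^2 = (u'-u) * ((a + b*(u+u'))^2 - b^2*u*u')
  have hid : u' * (a + u' * b) ^ 2 - u * (a + u * b) ^ 2 = (u' - u) * ((a + b * (u + u')) ^ 2 - b ^ 2 * (u * u')) := by ring
  have hpos : 0 < (a + b * (u + u')) ^ 2 - b ^ 2 * (u * u') := by
    rcases le_or_gt b 0 with hb | hb
    · -- a + b(u+u') = t + b u' ≤ t < 0, and |.| ≥ |b| u' ≥ |b| √(uu')
      have h1 : a + b * (u + u') ≤ t + b * u' := by nlinarith
      have h2 : t + b * u' < 0 := by nlinarith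
      -- (a + b(u+u'))^2 ≥ (t + b u')^2 > (b u')^2 ≥ b^2 u u'
      have h3 : (t + b * u') ^ 2 ≤ (a + b * (u + u')) ^ 2 := by nlinarith
      have h4 : b ^ 2 * (u * u') ≤ (b * u') ^ 2 := by nlinarith [sq_nonneg b, mul_pos hu (by linarith : (0:ℝ) < u')]
      have h5 : (b * u') ^ 2 < (t + b * u') ^ 2 := by
        have h6 : t + 2 * (b * u') < 0 := by nlinarith
        nlinarith [mul_pos_of_neg_of_neg ht h6]
      linarith
    · -- b > 0: a + b(u+u') = t + b u' ≤ t + (7/5) u b < t - (21/50)·t·… : use 10ub < -3t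
      have h1 : a + b * (u + u') = t + b * u' := by rw [htab]; ring
      have h2 : b * u' ≤ 7 / 5 * (u * b) := by nlinarith
      have h3 : t + b * u' < 0 := by nlinarith
      have h3' : -(t + b * u') > 29 / 50 * (-t) := by nlinarith
      have h4 : b ^ 2 * (u * u') ≤ (b * u') ^ 2 := by nlinarith [sq_nonneg b, mul_pos hu (by linarith : (0:ℝ) < u')]
      have h5 : (b * u') ^ 2 < (29 / 50 * (-t)) ^ 2 := by
        have : b * u' < 29 / 50 * (-t) := by nlinarith
        have hbu : 0 < b * u' := by nlinarith
        nlinarith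
      rw [h1]
      nlinarith
  have : 0 < u' * (a + u' * b) ^ 2 - u * (a + u * b) ^ 2 := by rw [hid]; exact mul_pos (by linarith) hpos
  rw [htab]; linarith

/-! ## 4. Bottom eigenpairs exist (spectral theorem) -/

/-- Every real symmetric `3 × 3` matrix `M` has a unit vector `x` and a real `t` with `M x = t x` and `t|y|² ≤ σ_M(y)` for all `y` (a bottom eigenpair). [folklore] -/
theorem exists_bottom_pair {M : Matrix (Fin 3) (Fin 3) ℝ} (hM : M.IsSymm) :
    ∃ (t : ℝ) (x : Fin 3 → ℝ), x ⬝ᵥ x = 1 ∧ M *ᵥ x = t • x ∧ ∀ y : Fin 3 → ℝ, t * (y ⬝ᵥ y) ≤ y ⬝ᵥ M *ᵥ y := by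
  have hH : M.IsHermitian := Matrix.isHermitian_iff_isSymm.2 hM
  set U : Matrix (Fin 3) (Fin 3) ℝ := (hH.eigenvectorUnitary : Matrix (Fin 3) (Fin 3) ℝ) with hUdef
  set e : Fin 3 → ℝ := hH.eigenvalues with he
  have hMeq : M = U * Matrix.diagonal e * star U := by
    simpa [Unitary.conjStarAlgAut_apply, hUdef, he] using hH.spectral_theorem
  have hstar : star U = Uᵀ := by
    rw [Matrix.star_eq_conjTranspose, Matrix.conjTranspose_eq_transpose_of_trivial]
  have hVU : Uᵀ * U = 1 := by rw [← hstar]; exact Unitary.coe_star_mul_self _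
  have hUV : U * Uᵀ = 1 := by rw [← hstar]; exact Unitary.coe_mul_star_self _
  rw [hstar] at hMeq
  have hDconj : Uᵀ * M * U = Matrix.diagonal e := by
    rw [hMeq]
    calc Uᵀ * (U * Matrix.diagonal e * Uᵀ) * U = (Uᵀ * U) * Matrix.diagonal e * (Uᵀ * U) := by simp only [Matrix.mul_assoc]
      _ = Matrix.diagonal e := by rw [hVU, Matrix.one_mul, Matrix.mul_one]
  -- an index of a minimal eigenvalue
  obtain ⟨i, -, hi⟩ := Finset.exists_min_image Finset.univ e Finset.univ_nonempty
  refine ⟨e i, U *ᵥ (Pi.single i 1), ?_, ?_, ?_⟩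
  · have h := dotProduct_conj U 1 (Pi.single i 1) (Pi.single i 1)
    rw [Matrix.one_mulVec, Matrix.mul_one, hVU, Matrix.one_mulVec] at h
    rw [h]; simp
  · have hcol : U *ᵥ (Pi.single i 1) = fun j => U j i := by
      ext j; simp [Matrix.mulVec, dotProduct, Pi.single_apply, Finset.sum_ite_eq', Finset.mem_univ]
    have h := hH.mulVec_eigenvectorBasis i
    have hUcol : (fun j => U j i) = ⇑(hH.eigenvectorBasis i) := by
      ext j; rw [hUdef, Matrix.IsHermitian.eigenvectorUnitary_apply]
    rw [hcol, hUcol, h]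
  · intro y
    -- y = U (Uᵀ y); σ_M(y) = σ_D(Uᵀ y) = Σ e_j (Uᵀy)_j² ≥ e_i |Uᵀ y|² = e_i |y|²
    set z : Fin 3 → ℝ := Uᵀ *ᵥ y with hz
    have hUz : U *ᵥ z = y := by rw [hz, Matrix.mulVec_mulVec, hUV, Matrix.one_mulVec]
    have hyy : y ⬝ᵥ y = z ⬝ᵥ z := by
      have h := dotProduct_conj U 1 z z
      rw [Matrix.one_mulVec, Matrix.mul_one, hVU, Matrix.one_mulVec, hUz] at h
      exact h
    have hσ : y ⬝ᵥ M *ᵥ y = z ⬝ᵥ (Matrix.diagonal e) *ᵥ z := by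
      have h := dotProduct_conj U M z z
      rw [hUz, hDconj] at h
      exact h
    rw [hyy, hσ]
    have h1 : z ⬝ᵥ Matrix.diagonal e *ᵥ z = ∑ j, e j * (z j * z j) := by
      simp [dotProduct, Matrix.mulVec_diagonal]; exact Finset.sum_congr rfl fun j _ => by ring
    have h2 : z ⬝ᵥ z = ∑ j, z j * z j := by simp [dotProduct]
    rw [h1, h2, Finset.mul_sum]
    exact Finset.sum_le_sum fun j _ => mul_le_mul_of_nonneg_right (hi j (Finset.mem_univ j)) (mul_self_nonneg (z j))

/-! ## 5. The weight `u·λ_min(A+uB)²` increases along the pencil -/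

/-- A bottom pair has `t = σ_A(x) + u·σ_B(x)` (bookkeeping). [folklore] -/
theorem bottom_tab {A B : Matrix (Fin 3) (Fin 3) ℝ} {u t : ℝ} {x : Fin 3 → ℝ} (hx1 : x ⬝ᵥ x = 1)
    (heig : (A + u • B) *ᵥ x = t • x) : t = x ⬝ᵥ A *ᵥ x + u * (x ⬝ᵥ B *ᵥ x) := by
  have h := congrArg (fun v => x ⬝ᵥ v) heig
  simp only [Matrix.add_mulVec, Matrix.smul_mulVec, dotProduct_add, dotProduct_smul, smul_eq_mul, hx1, mul_one] at h
  linarith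

/-- A bottom value is negative when `tr A < 0`, `tr B < 0`, `u > 0` (`3t ≤ tr(A + uB)`). [folklore] -/
theorem bottom_neg {A B : Matrix (Fin 3) (Fin 3) ℝ} (htr : A.trace < 0) (htrB : B.trace < 0) {u t : ℝ} (hu : 0 < u)
    (hmin : ∀ y : Fin 3 → ℝ, t * (y ⬝ᵥ y) ≤ y ⬝ᵥ (A + u • B) *ᵥ y) : t < 0 := by
  have h0 := hmin ![1, 0, 0]
  have h1 := hmin ![0, 1, 0]
  have h2 := hmin ![0, 0, 1]
  simp [Matrix.mulVec, dotProduct, Fin.sum_univ_three, Matrix.add_apply, Matrix.smul_apply] at h0 h1 h2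
  rw [Matrix.trace_fin_three] at htr htrB
  nlinarith

/-- **One step**: for bottom pairs `(t,x)` at `u` and `(t',x')` at `u' ∈ (u, 7u/5]`, the weight increases: `u·t² < u'·t'²`. [folklore] -/
theorem weight_step_pairs {A B : Matrix (Fin 3) (Fin 3) ℝ} (hA : A.IsSymm)
    (hdet : 0 < A.det) (he2 : 0 < A.adjugate.trace) (htr : A.trace < 0)
    (htrB : B.trace < 0) (hMX : A.trace * B.trace - (A * B).trace < 0)
    {u u' t t' : ℝ} (hu : 0 < u) (huu : u < u') (hu' : u' ≤ 7 / 5 * u)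
    {x : Fin 3 → ℝ} (hx1 : x ⬝ᵥ x = 1) (heig : (A + u • B) *ᵥ x = t • x)
    (hmin : ∀ y : Fin 3 → ℝ, t * (y ⬝ᵥ y) ≤ y ⬝ᵥ (A + u • B) *ᵥ y)
    (hmin' : ∀ y : Fin 3 → ℝ, t' * (y ⬝ᵥ y) ≤ y ⬝ᵥ (A + u' • B) *ᵥ y) :
    u * t ^ 2 < u' * t' ^ 2 := by
  have hlaw := chamberII_logSlope_strong hA hdet he2 htr htrB hMX hu hx1 heig hmin
  have htab := bottom_tab hx1 heig
  have ht := bottom_neg htr htrB hu hmin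
  obtain ⟨hneg, hstep⟩ := weight_step (a := x ⬝ᵥ A *ᵥ x) (b := x ⬝ᵥ B *ᵥ x) hu huu hu' htab ht hlaw
  -- Rayleigh at u' with the old eigenvector: t' ≤ a + u' b < 0
  have hR := hmin' x
  simp only [Matrix.add_mulVec, Matrix.smul_mulVec, dotProduct_add, dotProduct_smul, smul_eq_mul, hx1, mul_one] at hR
  have ht'le : t' ≤ x ⬝ᵥ A *ᵥ x + u' * (x ⬝ᵥ B *ᵥ x) := hR
  have hsq : (x ⬝ᵥ A *ᵥ x + u' * (x ⬝ᵥ B *ᵥ x)) ^ 2 ≤ t' ^ 2 := by nlinarith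
  have hu'0 : 0 < u' := by linarith
  nlinarith

/-- **The weight is increasing**: for ALL `0 < u < u'` and bottom pairs at `u`, `u'`: `u·t² < u'·t'²` (induction on `7/5`-steps, using
`exists_bottom_pair` at the intermediate points; `A`, `B` symmetric). [folklore] -/
theorem weight_increasing {A B : Matrix (Fin 3) (Fin 3) ℝ} (hA : A.IsSymm) (hB : B.IsSymm)
    (hdet : 0 < A.det) (he2 : 0 < A.adjugate.trace) (htr : A.trace < 0)
    (htrB : B.trace < 0) (hMX : A.trace * B.trace - (A * B).trace < 0) :
    ∀ (n : ℕ) {u u' t t' : ℝ} {x x' : Fin 3 → ℝ}, 0 < u → u < u' → u' ≤ (7 / 5) ^ n * u →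
      x ⬝ᵥ x = 1 → (A + u • B) *ᵥ x = t • x → (∀ y : Fin 3 → ℝ, t * (y ⬝ᵥ y) ≤ y ⬝ᵥ (A + u • B) *ᵥ y) →
      x' ⬝ᵥ x' = 1 → (A + u' • B) *ᵥ x' = t' • x' → (∀ y : Fin 3 → ℝ, t' * (y ⬝ᵥ y) ≤ y ⬝ᵥ (A + u' • B) *ᵥ y) →
      u * t ^ 2 < u' * t' ^ 2 := by
  intro n
  induction n with
  | zero =>
    intro u u' t t' x x' hu huu hu' _ _ _ _ _ _
    rw [pow_zero, one_mul] at hu'; linarith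
  | succ n ih =>
    intro u u' t t' x x' hu huu hu' hx1 heig hmin hx1' heig' hmin'
    by_cases hcase : u' ≤ 7 / 5 * u
    · exact weight_step_pairs hA hdet he2 htr htrB hMX hu huu hcase hx1 heig hmin hmin'
    · push Not at hcase
      -- intermediate point v = 7u/5 with a bottom pair
      set v : ℝ := 7 / 5 * u with hv
      have hMsymm : (A + v • B).IsSymm := hA.add (hB.smul v)
      obtain ⟨tv, xv, hxv1, heigv, hminv⟩ := exists_bottom_pair hMsymm
      have hv0 : 0 < v := by rw [hv]; linarith
      have huv : u < v := by rw [hv]; linarith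
      have step1 := weight_step_pairs hA hdet he2 htr htrB hMX hu huv (le_of_eq hv) hx1 heig hmin hminv
      have hu'' : u' ≤ (7 / 5) ^ n * v := by rw [hv, ← mul_assoc, ← pow_succ]; exact hu'
      have step2 := ih hv0 hcase hu'' hxv1 heigv hminv hx1' heig' hmin'
      linarith

/-- Unrestricted form: `0 < u < u'` ⇒ `u·t² < u'·t'²` for bottom pairs (choose `n` with `(7/5)^n ≥ u'/u`). [folklore] -/
theorem weight_increasing' {A B : Matrix (Fin 3) (Fin 3) ℝ} (hA : A.IsSymm) (hB : B.IsSymm)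
    (hdet : 0 < A.det) (he2 : 0 < A.adjugate.trace) (htr : A.trace < 0)
    (htrB : B.trace < 0) (hMX : A.trace * B.trace - (A * B).trace < 0)
    {u u' t t' : ℝ} {x x' : Fin 3 → ℝ} (hu : 0 < u) (huu : u < u')
    (hx1 : x ⬝ᵥ x = 1) (heig : (A + u • B) *ᵥ x = t • x) (hmin : ∀ y : Fin 3 → ℝ, t * (y ⬝ᵥ y) ≤ y ⬝ᵥ (A + u • B) *ᵥ y)
    (hx1' : x' ⬝ᵥ x' = 1) (heig' : (A + u' • B) *ᵥ x' = t' • x') (hmin' : ∀ y : Fin 3 → ℝ, t' * (y ⬝ᵥ y) ≤ y ⬝ᵥ (A + u' • B) *ᵥ y) :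
    u * t ^ 2 < u' * t' ^ 2 := by
  obtain ⟨n, hn⟩ := pow_unbounded_of_one_lt (u' / u) (by norm_num : (1:ℝ) < 7 / 5)
  have hu'n : u' ≤ (7 / 5) ^ n * u := by
    have := (div_lt_iff₀ hu).1 hn
    linarith
  exact weight_increasing hA hB hdet he2 htr htrB hMX n hu huu hu'n hx1 heig hmin hx1' heig' hmin'

/-! ## 6. At most one PSD-singular point for a chamber-II nine-row -/

/-- From a PSD-singular point of `1 + x^{d₁}S₁ + x^{d₂}S₂` (`x > 0`) to a bottom pair of `S₁ + x^{d₂−d₁}S₂` with value `−(x^{d₁})⁻¹`. [folklore] -/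
theorem bottom_pair_of_psdSingular (d : Fin 3 → ℕ) (S : Fin 3 → Matrix (Fin 3) (Fin 3) ℝ) (h0 : d 0 = 0) (hS0 : S 0 = 1)
    (h12 : d 1 ≤ d 2) {x : ℝ} (hx : 0 < x)
    (hpsd : (∑ l, x ^ d l • S l).PosSemidef) {k : Fin 3 → ℝ} (hk : k ≠ 0) (hker : (∑ l, x ^ d l • S l) *ᵥ k = 0) :
    ∃ y : Fin 3 → ℝ, y ⬝ᵥ y = 1 ∧ (S 1 + x ^ (d 2 - d 1) • S 2) *ᵥ y = (-(x ^ d 1)⁻¹) • y ∧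
      ∀ z : Fin 3 → ℝ, (-(x ^ d 1)⁻¹) * (z ⬝ᵥ z) ≤ z ⬝ᵥ (S 1 + x ^ (d 2 - d 1) • S 2) *ᵥ z := by
  have hx1pos : 0 < x ^ d 1 := pow_pos hx _
  have hsum : (∑ l, x ^ d l • S l) = 1 + x ^ d 1 • (S 1 + x ^ (d 2 - d 1) • S 2) := by
    rw [Fin.sum_univ_three, h0, pow_zero, one_smul, hS0, smul_add, smul_smul, ← pow_add, Nat.add_sub_cancel' h12, add_assoc]
  -- kernel equation for the inner pencil
  have hker' : (S 1 + x ^ (d 2 - d 1) • S 2) *ᵥ k = (-(x ^ d 1)⁻¹) • k := by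
    rw [hsum, Matrix.add_mulVec, Matrix.one_mulVec, Matrix.smul_mulVec] at hker
    have : x ^ d 1 • ((S 1 + x ^ (d 2 - d 1) • S 2) *ᵥ k) = -k := by
      rw [← sub_eq_zero]; rw [← hker]; abel
    calc (S 1 + x ^ (d 2 - d 1) • S 2) *ᵥ k = (x ^ d 1)⁻¹ • (x ^ d 1 • ((S 1 + x ^ (d 2 - d 1) • S 2) *ᵥ k)) := by
          rw [smul_smul, inv_mul_cancel₀ hx1pos.ne', one_smul]
      _ = (-(x ^ d 1)⁻¹) • k := by rw [this, smul_neg, neg_smul]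
  -- PSD ⇒ Rayleigh minimality with value −(x^{d₁})⁻¹
  have hminR : ∀ z : Fin 3 → ℝ, (-(x ^ d 1)⁻¹) * (z ⬝ᵥ z) ≤ z ⬝ᵥ (S 1 + x ^ (d 2 - d 1) • S 2) *ᵥ z := by
    intro z
    have hz := hpsd.dotProduct_mulVec_nonneg z
    rw [star_trivial, hsum, Matrix.add_mulVec, Matrix.one_mulVec, Matrix.smul_mulVec, dotProduct_add, dotProduct_smul,
      smul_eq_mul] at hz
    -- 0 ≤ z·z + x^{d1} σ(z)  ⇒  −(x^{d1})⁻¹ (z·z) ≤ σ(z)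
    have h := mul_nonneg (inv_nonneg.2 hx1pos.le) hz
    rw [mul_add, ← mul_assoc, inv_mul_cancel₀ hx1pos.ne', one_mul] at h
    linarith
  -- normalise k
  have hkk : 0 < k ⬝ᵥ k := by
    have h0' : 0 ≤ k ⬝ᵥ k := by simpa using dotProduct_star_self_nonneg k
    have hne : k ⬝ᵥ k ≠ 0 := fun h => hk (dotProduct_self_eq_zero.1 h)
    exact lt_of_le_of_ne h0' (Ne.symm hne)
  set c : ℝ := (Real.sqrt (k ⬝ᵥ k))⁻¹ with hc
  have hc2 : c * c * (k ⬝ᵥ k) = 1 := by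
    rw [hc, ← mul_inv, Real.mul_self_sqrt hkk.le, inv_mul_cancel₀ hkk.ne']
  refine ⟨c • k, ?_, ?_, hminR⟩
  · rw [smul_dotProduct, dotProduct_smul, smul_eq_mul, smul_eq_mul, ← mul_assoc, hc2]
  · rw [Matrix.mulVec_smul, hker', smul_comm]

/-- **CHAMBER-II NINE-ROWS HAVE AT MOST ONE PSD-SINGULAR POINT.**  Let `F = 1 + X^{d₁}S₁ + X^{d₂}S₂` (`d₀ = 0`, `2d₁ < d₂ < 3d₁`, `S₁, S₂` real
symmetric) have NINE distinct positive det-roots.  If `F(x₁)` and `F(x₂)` are both positive semidefinite and singular with `0 < x₁ ≤ x₂`, then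
`x₁ = x₂`.  Hence (with `Census.FlagInertia`) such a nine-row is never the source of the flag ladder: that would need all nine roots PSD-singular.
[folklore] -/
theorem chamberII_unique_psdSingular (d : Fin 3 → ℕ) (S : Fin 3 → Matrix (Fin 3) (Fin 3) ℝ) (hS : ∀ l, (S l).IsSymm)
    (h9 : 9 ≤ ((Matrix.det (∑ l, ((Polynomial.X : Polynomial ℝ) ^ d l) • (S l).map Polynomial.C)).roots.toFinset.filter
      (fun t => 0 < t)).card)
    (h0 : d 0 = 0) (hS0 : S 0 = 1) (hIIa : 2 * d 1 < d 2) (hIIb : d 2 < 3 * d 1)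
    {x₁ x₂ : ℝ} (hx₁ : 0 < x₁) (hle : x₁ ≤ x₂)
    (hpsd₁ : (∑ l, x₁ ^ d l • S l).PosSemidef) {k₁ : Fin 3 → ℝ} (hk₁ : k₁ ≠ 0) (hker₁ : (∑ l, x₁ ^ d l • S l) *ᵥ k₁ = 0)
    (hpsd₂ : (∑ l, x₂ ^ d l • S l).PosSemidef) {k₂ : Fin 3 → ℝ} (hk₂ : k₂ ≠ 0) (hker₂ : (∑ l, x₂ ^ d l • S l) *ᵥ k₂ = 0) :
    x₁ = x₂ := by
  by_contra hne
  have hlt : x₁ < x₂ := lt_of_le_of_ne hle hne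
  have hx₂ : 0 < x₂ := lt_of_lt_of_le hx₁ hle
  have h12 : d 1 ≤ d 2 := by omega
  -- the letters' sign data (chamber II, S₀ = 1)
  have hdet0 : 0 < (S 0).det := by rw [hS0, Matrix.det_one]; exact one_pos
  obtain ⟨t1, t2, t3, t4, t5, -, -, -, -⟩ := signs_chamber_II d S h9 h0 hdet0 hIIa hIIb
  rw [hS0, Matrix.adjugate_one, Matrix.one_mul] at t1 t3
  rw [hS0, Matrix.mul_one] at t2
  rw [hS0, adjugate_polar_one_fin_three, Matrix.sub_mul, Matrix.smul_mul, Matrix.one_mul, Matrix.trace_sub,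
    Matrix.trace_smul, smul_eq_mul] at t5
  have hMX : (S 1).trace * (S 2).trace - (S 1 * S 2).trace < 0 := by linarith
  -- bottom pairs at u₁ = x₁^{d₂−d₁}, u₂ = x₂^{d₂−d₁}
  obtain ⟨y₁, hy₁, heig₁, hmin₁⟩ := bottom_pair_of_psdSingular d S h0 hS0 h12 hx₁ hpsd₁ hk₁ hker₁
  obtain ⟨y₂, hy₂, heig₂, hmin₂⟩ := bottom_pair_of_psdSingular d S h0 hS0 h12 hx₂ hpsd₂ hk₂ hker₂
  have hu₁ : 0 < x₁ ^ (d 2 - d 1) := pow_pos hx₁ _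
  have hd21 : 0 < d 2 - d 1 := by omega
  have huu : x₁ ^ (d 2 - d 1) < x₂ ^ (d 2 - d 1) := pow_lt_pow_left₀ hlt hx₁.le hd21.ne'
  have W := weight_increasing' (hS 1) (hS 2) t4 t2 t1 t3 hMX hu₁ huu hy₁ heig₁ hmin₁ hy₂ heig₂ hmin₂
  -- W says x₁^{d₂−d₁}·x₁^{−2d₁} < x₂^{d₂−d₁}·x₂^{−2d₁}; but d₂ < 3d₁ makes this weight DECREASING in x
  have hp1 : 0 < x₁ ^ d 1 := pow_pos hx₁ _
  have hp2 : 0 < x₂ ^ d 1 := pow_pos hx₂ _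
  rw [neg_sq, neg_sq, inv_pow, inv_pow] at W
  -- clear denominators: x₁^{e}·x₂^{2d₁} < x₂^{e}·x₁^{2d₁} with e = d₂ − d₁ < 2d₁
  have hW : x₁ ^ (d 2 - d 1) * (x₂ ^ d 1) ^ 2 < x₂ ^ (d 2 - d 1) * (x₁ ^ d 1) ^ 2 := by
    have h1 : x₁ ^ (d 2 - d 1) * ((x₁ ^ d 1) ^ 2)⁻¹ * ((x₁ ^ d 1) ^ 2 * (x₂ ^ d 1) ^ 2)
        = x₁ ^ (d 2 - d 1) * (x₂ ^ d 1) ^ 2 := by field_simp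
    have h2 : x₂ ^ (d 2 - d 1) * ((x₂ ^ d 1) ^ 2)⁻¹ * ((x₁ ^ d 1) ^ 2 * (x₂ ^ d 1) ^ 2)
        = x₂ ^ (d 2 - d 1) * (x₁ ^ d 1) ^ 2 := by field_simp
    have hpos : 0 < (x₁ ^ d 1) ^ 2 * (x₂ ^ d 1) ^ 2 := by positivity
    have := mul_lt_mul_of_pos_right W hpos
    rw [h1, h2] at this
    exact this
  -- write 2d₁ = (d₂ − d₁) + (3d₁ − d₂)
  have hsplit : 2 * d 1 = (d 2 - d 1) + (3 * d 1 - d 2) := by omega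
  have e1 : (x₁ ^ d 1) ^ 2 = x₁ ^ (d 2 - d 1) * x₁ ^ (3 * d 1 - d 2) := by rw [← pow_mul, mul_comm, hsplit, pow_add]
  have e2 : (x₂ ^ d 1) ^ 2 = x₂ ^ (d 2 - d 1) * x₂ ^ (3 * d 1 - d 2) := by rw [← pow_mul, mul_comm, hsplit, pow_add]
  rw [e1, e2] at hW
  -- hW : x₁^e (x₂^e x₂^f) < x₂^e (x₁^e x₁^f)  ⇒  x₂^f < x₁^f, contradicting x₁ < x₂
  have hf : 0 < 3 * d 1 - d 2 := by omega
  have hlt' : x₁ ^ (3 * d 1 - d 2) < x₂ ^ (3 * d 1 - d 2) := pow_lt_pow_left₀ hlt hx₁.le hf.ne'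
  have hu₂ : 0 < x₂ ^ (d 2 - d 1) := pow_pos hx₂ _
  nlinarith [mul_pos hu₁ hu₂, mul_lt_mul_of_pos_left hlt' (mul_pos hu₁ hu₂)]

end NineInertia

end Summit.ValiantsHypothesis.ValiantsHypothesis.Theorems.LacunarySymmetroidMatrixDescartes.Census
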